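import Literature.AlgebraicGeometry.Motives.CubeStepIRing
import Literature.AlgebraicGeometry.Motives.CubeLocalComparison
import Mathlib.AlgebraicGeometry.Morphisms.Proper
import HarnessLib

/-!
# Step (I) of the cube at a point of the base: triviality on the infinitesimal neighbourhoods `(X ×_R Y) ×_R Spec(𝒪_{W,t}/𝔪^{n+1})`

Layer `Literature/AlgebraicGeometry/Motives`, namespace `Literature.AlgebraicGeometry.Motives`.  THEOREMS ONLY (no definition, no named
fact, no instance, no notation).  Cell `hodgecm-mathlib` (D-0151), F-2d road (R-def) «theorem of the cube over a NON-reduced base», brick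
D5c-α2 (author B-p07 (g16)): ★ `cubeStepI_localRing` (Step (I) over the local ring `A = 𝒪_{W,t}`, for `X_A ⊗ Y_A`) transported to the
`R`-level family `(X ⊗ Y) ⊗ W → W` through ★ `CubeLocalComparison`, giving the hypothesis `h` of ★ `CubeSeesawKrull` at the point `t`:
**`nonempty_unit_iso_infinitesimal`** — for `X Y W : SchemeOver R` (`X`, `Y` flat and proper over `Spec R` with
sections `x`, `y` whose underlying morphisms are affine; `W` locally noetherian), a point `t ∈ W`, the `κ(t)`-fibres of `X`, `Y` proper and
geometrically integral, Stein for `X`, `Y` over the Artinian quotients of `𝒪_{W,t}`, and a rank-one `N` on `(X ⊗ Y) ⊗ W` trivial on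
`({x} × Y) × W`, `(X × {y}) × W` and on `(X ⊗ Y) × {t}`: `N` is trivial on `(X ⊗ Y) ⊗ Spec(𝒪_{W,t}/𝔪^{n+1})` for all `n`
([GortzWedhorn2023] Lemma 24.72 Step (I) at the point `t`; [MumfordAV1970] §6).

HC_CM is proved only modulo the 7 printed citations until rung 0 closes; nothing here is about HC.

## References
* [GortzWedhorn2023] U. Görtz, T. Wedhorn, *Algebraic Geometry II* (2023), Lemma 24.72 proof Step (I) (p. 409).
* [MumfordAV1970] D. Mumford, *Abelian Varieties* (1970), §6, the theorem of the cube (proof).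
-/

noncomputable section

universe u

open CategoryTheory CategoryTheory.Limits AlgebraicGeometry MonoidalCategory CartesianMonoidalCategory TensorProduct
open IsLocalRing
open Literature.AlgebraicGeometry.Morphisms Literature.AlgebraicGeometry.Modules
open Literature.AlgebraicGeometry.AbelianSchemes.AbelianSchemeOver

namespace Literature.AlgebraicGeometry.Motives

variable {R : Type u} [CommRing R]

/-- `((Over.pullback ρ).map φ).left` is an affine morphism when `φ.left` is (it is a base change of `φ.left`; private).
[folklore] -/
private theorem isAffineHom_pullback_map_left {A : Type u} [CommRing A] (ρ : Spec (.of A) ⟶ Spec (.of R)) {U V : SchemeOver R}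
    (φ : U ⟶ V) [IsAffineHom φ.left] : IsAffineHom ((Over.pullback ρ).map φ).left := by
  have e : ((Over.pullback ρ).map φ).left = pullback.map U.hom ρ V.hom ρ φ.left (𝟙 _) (𝟙 _)
      ((Category.comp_id _).trans (Over.w φ).symm) ((Category.comp_id _).trans (Category.id_comp _).symm) := by
    apply pullback.hom_ext
    · simp only [Over.pullback, Over.homMk_left, pullback.map]
      erw [pullback.lift_fst]
    · simp only [Over.pullback, Over.homMk_left, pullback.map]
      erw [pullback.lift_snd]
  rw [e]
  exact MorphismProperty.pullbackMap (P := @IsAffineHom) (f := U.hom) (g := ρ) (f' := V.hom) (g' := ρ) (i₁ := φ.left)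
    (i₂ := 𝟙 _) ‹IsAffineHom φ.left› inferInstance (Over.w φ).symm (Category.id_comp _).symm

/-- The slice `{x} × Y → X ⊗ Y` is an affine morphism when `x : Spec R → X` is (private). [folklore] -/
private theorem isAffineHom_sliceLeft_left {X : SchemeOver R} (x : 𝟙_ (SchemeOver R) ⟶ X) [IsAffineHom x.left]
    (Y : SchemeOver R) : IsAffineHom ((λ_ Y).inv ≫ x ▷ Y).left := by
  rw [Over.comp_left, Over.whiskerRight_left]
  exact MorphismProperty.comp_mem @IsAffineHom _ _ inferInstance (MorphismProperty.pullbackMap (P := @IsAffineHom)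
    (f := (𝟙_ (SchemeOver R)).hom) (g := Y.hom) (f' := X.hom) (g' := Y.hom) (i₁ := x.left) (i₂ := 𝟙 _)
    ‹IsAffineHom x.left› inferInstance (Over.w x).symm (Category.id_comp _).symm)

/-- The slice `X × {y} → X ⊗ Y` is an affine morphism when `y : Spec R → Y` is (private). [folklore] -/
private theorem isAffineHom_sliceRight_left (X : SchemeOver R) {Y : SchemeOver R} (y : 𝟙_ (SchemeOver R) ⟶ Y)
    [IsAffineHom y.left] : IsAffineHom ((ρ_ X).inv ≫ X ◁ y).left := by
  rw [Over.comp_left, Over.whiskerLeft_left]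
  exact MorphismProperty.comp_mem @IsAffineHom _ _ inferInstance (MorphismProperty.pullbackMap (P := @IsAffineHom)
    (f := X.hom) (g := (𝟙_ (SchemeOver R)).hom) (f' := X.hom) (g' := Y.hom) (i₁ := 𝟙 _) (i₂ := y.left) inferInstance
    ‹IsAffineHom y.left› (Category.id_comp _).symm (Over.w y).symm)

/-- The slice `{x_A} × Y_A → X_A ⊗ Y_A` of the base change to `Spec A` is an affine morphism when `x.left` is (private).
[folklore] -/
private theorem isAffineHom_sliceLeft_pullback_left {A : Type u} [CommRing A] (ρ : Spec (.of A) ⟶ Spec (.of R))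
    {X : SchemeOver R} (x : 𝟙_ (SchemeOver R) ⟶ X) [IsAffineHom x.left] (Y : SchemeOver R) :
    IsAffineHom ((λ_ ((Over.pullback ρ).obj Y)).inv ≫
      (Functor.LaxMonoidal.ε (Over.pullback ρ) ≫ (Over.pullback ρ).map x) ▷ (Over.pullback ρ).obj Y).left := by
  have e : ((λ_ ((Over.pullback ρ).obj Y)).inv ≫
      (Functor.LaxMonoidal.ε (Over.pullback ρ) ≫ (Over.pullback ρ).map x) ▷ (Over.pullback ρ).obj Y) =
      (Over.pullback ρ).map ((λ_ Y).inv ≫ x ▷ Y) ≫ (Functor.Monoidal.μIso (Over.pullback ρ) X Y).inv := by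
    rw [← slice_tensorator_eq_map, Category.assoc, Iso.hom_inv_id, Category.comp_id]
  rw [e, Over.comp_left]
  haveI := isAffineHom_sliceLeft_left x Y
  haveI := isAffineHom_pullback_map_left ρ ((λ_ Y).inv ≫ x ▷ Y)
  infer_instance

/-- The slice `X_A × {y_A} → X_A ⊗ Y_A` of the base change to `Spec A` is an affine morphism when `y.left` is (private).
[folklore] -/
private theorem isAffineHom_sliceRight_pullback_left {A : Type u} [CommRing A] (ρ : Spec (.of A) ⟶ Spec (.of R))
    (X : SchemeOver R) {Y : SchemeOver R} (y : 𝟙_ (SchemeOver R) ⟶ Y) [IsAffineHom y.left] :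
    IsAffineHom ((ρ_ ((Over.pullback ρ).obj X)).inv ≫
      (Over.pullback ρ).obj X ◁ (Functor.LaxMonoidal.ε (Over.pullback ρ) ≫ (Over.pullback ρ).map y)).left := by
  have e : ((ρ_ ((Over.pullback ρ).obj X)).inv ≫
      (Over.pullback ρ).obj X ◁ (Functor.LaxMonoidal.ε (Over.pullback ρ) ≫ (Over.pullback ρ).map y)) =
      (Over.pullback ρ).map ((ρ_ X).inv ≫ X ◁ y) ≫ (Functor.Monoidal.μIso (Over.pullback ρ) X Y).inv := by
    rw [← slice_tensorator_eq_map', Category.assoc, Iso.hom_inv_id, Category.comp_id]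
  rw [e, Over.comp_left]
  haveI := isAffineHom_sliceRight_left X y
  haveI := isAffineHom_pullback_map_left ρ ((ρ_ X).inv ≫ X ◁ y)
  infer_instance

/-- Reassociation `e ≫ q ≫ m ≫ w = p` from `e ≫ q ≫ m = k` and `k ≫ w = p` (private plumbing, stated in a general category so
that it applies by unification up to definitional unfolding of the objects). [folklore] -/
private theorem comp_comp_comp_eq_of_comp_comp_eq {C : Type*} [Category C] {P₁ P₂ P₃ P₄ P₅ : C} (e : P₁ ⟶ P₂) (q : P₂ ⟶ P₃)
    (m : P₃ ⟶ P₄) (w : P₄ ⟶ P₅) (k : P₁ ⟶ P₄) (h : e ≫ q ≫ m = k) (p : P₁ ⟶ P₅) (h' : k ≫ w = p) :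
    e ≫ q ≫ m ≫ w = p := by
  subst h h'
  simp only [Category.assoc]

/-- **Two base changes of the test object compose**: `(1 × s) ≫ (1 × aT) = 1 × u` for `s ≫ aT = u`, as maps
`P ×_B S → P ×_B T' → P ×_B T`. [cite: GortzWedhorn2020, Section (4.7) (pp. 107–108)] -/
theorem map_comp_map_eq_map {B P T T' S : Scheme.{u}} (fP : P ⟶ B) (fS : S ⟶ B) (ρ : T' ⟶ B) (w : T ⟶ B) (s : S ⟶ T')
    (hs : s ≫ ρ = fS) (aT : T' ⟶ T) (ha : aT ≫ w = ρ) (u : S ⟶ T) (hu : s ≫ aT = u) (hu' : u ≫ w = fS) :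
    pullback.map fP fS fP ρ (𝟙 P) s (𝟙 B) (by rw [Category.comp_id, Category.id_comp]) (by rw [Category.comp_id, hs]) ≫
        pullback.map fP ρ fP w (𝟙 P) aT (𝟙 B) (by rw [Category.comp_id, Category.id_comp]) (by rw [Category.comp_id, ha]) =
      pullback.map fP fS fP w (𝟙 P) u (𝟙 B) (by rw [Category.comp_id, Category.id_comp]) (by rw [Category.comp_id, hu']) := by
  subst hu
  apply pullback.hom_ext
  · simp only [pullback.map, Category.assoc, pullback.lift_fst, Category.comp_id]
  · simp only [pullback.map, Category.assoc, pullback.lift_snd, pullback.lift_snd_assoc]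

/-- **From the local family to a test object over the base**: for `v : S → S'` with `v ≫ u = s ≫ aT` (e.g. `Spec(A/𝔪) → Spec κ(t)`),
a morphism `(P ×_B T') ×_{T'} S → P ×_B S'` (first factor read through `m : Q → P ×_B T'` over `T'`) with
`e' ≫ (1 × u) = pr₁ ≫ m ≫ (1 × aT)`. [cite: GortzWedhorn2020, Section (4.7) (pp. 107–108)] -/
theorem exists_lift_comp_map_eq {B P T T' Q S S' : Scheme.{u}} (fP : P ⟶ B) (ρ : T' ⟶ B) (w : T ⟶ B) (aT : T' ⟶ T)
    (ha : aT ≫ w = ρ) (fQ : Q ⟶ T') (m : Q ⟶ pullback fP ρ) (hQ : m ≫ pullback.snd fP ρ = fQ) (s : S ⟶ T')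
    (u : S' ⟶ T) (v : S ⟶ S') (hv : v ≫ u = s ≫ aT) :
    ∃ e' : pullback fQ s ⟶ pullback fP (u ≫ w),
      e' ≫ pullback.map fP (u ≫ w) fP w (𝟙 P) u (𝟙 B) (by rw [Category.comp_id, Category.id_comp])
          (by rw [Category.comp_id]) =
        pullback.fst fQ s ≫ m ≫ pullback.map fP ρ fP w (𝟙 P) aT (𝟙 B) (by rw [Category.comp_id, Category.id_comp])
          (by rw [Category.comp_id, ha]) := by
  refine ⟨pullback.lift (pullback.fst fQ s ≫ m ≫ pullback.fst fP ρ) (pullback.snd fQ s ≫ v) ?_, ?_⟩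
  · rw [Category.assoc, Category.assoc, pullback.condition, ← Category.assoc m, hQ, pullback.condition_assoc, Category.assoc,
      ← Category.assoc v, hv, Category.assoc, ha]
  · apply pullback.hom_ext
    · simp only [pullback.map, Category.assoc, pullback.lift_fst, Category.comp_id]
    · simp only [pullback.map, Category.assoc, pullback.lift_snd, pullback.lift_snd_assoc]
      rw [hv, ← Category.assoc m, hQ, pullback.condition_assoc]

/-- **STEP (I) AT A POINT OF THE BASE** ([GortzWedhorn2023] Lemma 24.72 Step (I), [MumfordAV1970] §6): see the module docstring.  The
conclusion is the hypothesis `h` of ★ `exists_iso_pullback_snd_of_seesaw_of_infinitesimal` at the point `t`.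
[cite: GortzWedhorn2023, Lemma 24.72 proof Step (I) (p. 409)] [cite: MumfordAV1970, §6 (theorem of the cube, proof)] -/
theorem nonempty_unit_iso_infinitesimal (X Y W : SchemeOver R) [Flat X.hom] [Flat Y.hom] [IsProper X.hom] [IsProper Y.hom]
    [GeometricallyIntegral X.hom] [GeometricallyIntegral Y.hom]
    [IsLocallyNoetherian W.left] (x : 𝟙_ (SchemeOver R) ⟶ X) (y : 𝟙_ (SchemeOver R) ⟶ Y) [IsAffineHom x.left] [IsAffineHom y.left]
    (t : W.left)
    (hStX : ∀ n : ℕ, Function.Surjective (toSectionsBase (W.left.presheaf.stalk t)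
      (pullback.snd ((Over.pullback (W.left.fromSpecStalk t ≫ W.hom)).obj X).hom
        (Spec.map (CommRingCat.ofHom (algebraMap (W.left.presheaf.stalk t)
          (↑(W.left.presheaf.stalk t) ⧸ maximalIdeal (W.left.presheaf.stalk t) ^ (n + 1)))))) ⊤))
    (hStY : ∀ n : ℕ, Function.Surjective (toSectionsBase (W.left.presheaf.stalk t)
      (pullback.snd ((Over.pullback (W.left.fromSpecStalk t ≫ W.hom)).obj Y).hom
        (Spec.map (CommRingCat.ofHom (algebraMap (W.left.presheaf.stalk t)
          (↑(W.left.presheaf.stalk t) ⧸ maximalIdeal (W.left.presheaf.stalk t) ^ (n + 1)))))) ⊤))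
    (N : ((X ⊗ Y) ⊗ W).left.Modules) (hN : HasRank N 1)
    (h₁ : Nonempty (unitModule _ ≅ (Scheme.Modules.pullback (((λ_ Y).inv ≫ x ▷ Y) ▷ W).left).obj N))
    (h₂ : Nonempty (unitModule _ ≅ (Scheme.Modules.pullback (((ρ_ X).inv ≫ X ◁ y) ▷ W).left).obj N))
    (hfib : Nonempty (unitModule _ ≅ (Scheme.Modules.pullback ((X ⊗ Y) ◁ (Over.homMk (W.left.fromSpecResidueField t) rfl :
      Over.mk (W.left.fromSpecResidueField t ≫ W.hom) ⟶ W)).left).obj N))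
    (n : ℕ) (g : Spec (.of (↑(W.left.presheaf.stalk t) ⧸ maximalIdeal (W.left.presheaf.stalk t) ^ (n + 1))) ⟶ W.left)
    (hg : g = Spec.map (CommRingCat.ofHom (Ideal.Quotient.mk (maximalIdeal (W.left.presheaf.stalk t) ^ (n + 1)))) ≫
      W.left.fromSpecStalk t) :
    Nonempty (unitModule ((X ⊗ Y) ⊗ Over.mk (g ≫ W.hom)).left ≅
      (Scheme.Modules.pullback ((X ⊗ Y) ◁ (Over.homMk g rfl : Over.mk (g ≫ W.hom) ⟶ W)).left).obj N) := by
  -- (0) names: the local ring `𝒪_{W,t}`, `ρ' : Spec 𝒪_{W,t} → Spec R`, the base changes `X_A`, `Y_A`, the tensorator `μ`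
  let ρ' : Spec (W.left.presheaf.stalk t) ⟶ Spec (.of R) := W.left.fromSpecStalk t ≫ W.hom
  let a : Over.mk ρ' ⟶ W := Over.homMk (W.left.fromSpecStalk t) rfl
  let XA : SchemeOver ↑(W.left.presheaf.stalk t) := (Over.pullback ρ').obj X
  let YA : SchemeOver ↑(W.left.presheaf.stalk t) := (Over.pullback ρ').obj Y
  let xA : 𝟙_ (SchemeOver ↑(W.left.presheaf.stalk t)) ⟶ XA := Functor.LaxMonoidal.ε (Over.pullback ρ') ≫ (Over.pullback ρ').map x
  let yA : 𝟙_ (SchemeOver ↑(W.left.presheaf.stalk t)) ⟶ YA := Functor.LaxMonoidal.ε (Over.pullback ρ') ≫ (Over.pullback ρ').map y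
  let μ : XA ⊗ YA ≅ (Over.pullback ρ').obj (X ⊗ Y) := Functor.Monoidal.μIso (Over.pullback ρ') X Y
  let σ : ∀ m : ℕ, Spec (.of (↑(W.left.presheaf.stalk t) ⧸ maximalIdeal (W.left.presheaf.stalk t) ^ (m + 1))) ⟶
      Spec (W.left.presheaf.stalk t) := fun m =>
    Spec.map (CommRingCat.ofHom (algebraMap (W.left.presheaf.stalk t)
      (↑(W.left.presheaf.stalk t) ⧸ maximalIdeal (W.left.presheaf.stalk t) ^ (m + 1))))
  have hμ : μ.hom.left ≫ pullback.snd (X ⊗ Y).hom ρ' = (XA ⊗ YA).hom := Over.w μ.hom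
  have hμi : μ.inv.left ≫ μ.hom.left = 𝟙 _ := by rw [← Over.comp_left, Iso.inv_hom_id, Over.id_left]
  have hNA : HasRank ((Scheme.Modules.pullback (μ.hom.left ≫ ((X ⊗ Y) ◁ a).left)).obj N) 1 := hasRank_pullback _ hN
  -- (1) instances on the base changes
  haveI : Flat XA.hom := inferInstanceAs (Flat (pullback.snd X.hom ρ'))
  haveI : Flat YA.hom := inferInstanceAs (Flat (pullback.snd Y.hom ρ'))
  haveI : Flat (XA ⊗ YA).hom := inferInstanceAs (Flat (pullback.fst XA.hom YA.hom ≫ XA.hom))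
  haveI : IsSeparated XA.hom := MorphismProperty.pullback_snd (P := @IsSeparated) _ _ inferInstance
  haveI : IsSeparated YA.hom := MorphismProperty.pullback_snd (P := @IsSeparated) _ _ inferInstance
  haveI : IsSeparated (XA ⊗ YA).hom := by
    haveI : IsSeparated (pullback.fst XA.hom YA.hom) := MorphismProperty.pullback_fst (P := @IsSeparated) _ _ ‹_›
    exact inferInstanceAs (IsSeparated (pullback.fst XA.hom YA.hom ≫ XA.hom))
  haveI : QuasiCompact XA.hom := inferInstanceAs (QuasiCompact (pullback.snd X.hom ρ'))
  haveI : CompactSpace YA.left := inferInstanceAs (CompactSpace ↑(pullback Y.hom ρ'))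
  haveI : CompactSpace (XA ⊗ YA).left := inferInstanceAs (CompactSpace ↑(pullback XA.hom YA.hom))
  haveI : IsAffineHom ((λ_ YA).inv ≫ xA ▷ YA).left := isAffineHom_sliceLeft_pullback_left ρ' x Y
  haveI : IsAffineHom ((ρ_ XA).inv ≫ XA ◁ yA).left := isAffineHom_sliceRight_pullback_left ρ' X y
  haveI : IsProper XA.hom := MorphismProperty.pullback_snd (P := @IsProper) _ _ ‹IsProper X.hom›
  haveI : IsProper YA.hom := MorphismProperty.pullback_snd (P := @IsProper) _ _ ‹IsProper Y.hom›
  haveI : GeometricallyIntegral XA.hom := inferInstanceAs (GeometricallyIntegral (pullback.snd X.hom ρ'))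
  haveI : GeometricallyIntegral YA.hom := inferInstanceAs (GeometricallyIntegral (pullback.snd Y.hom ρ'))
  haveI hPX : IsProper ((Over.pullback (Spec.map (CommRingCat.ofHom (algebraMap ↑(W.left.presheaf.stalk t)
      (ResidueField ↑(W.left.presheaf.stalk t)))))).obj XA).hom :=
    MorphismProperty.pullback_snd (P := @IsProper) _ _ ‹IsProper XA.hom›
  haveI hPY : IsProper ((Over.pullback (Spec.map (CommRingCat.ofHom (algebraMap ↑(W.left.presheaf.stalk t)
      (ResidueField ↑(W.left.presheaf.stalk t)))))).obj YA).hom :=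
    MorphismProperty.pullback_snd (P := @IsProper) _ _ ‹IsProper YA.hom›
  haveI hGX : GeometricallyIntegral ((Over.pullback (Spec.map (CommRingCat.ofHom (algebraMap ↑(W.left.presheaf.stalk t)
      (ResidueField ↑(W.left.presheaf.stalk t)))))).obj XA).hom :=
    inferInstanceAs (GeometricallyIntegral (pullback.snd XA.hom _))
  haveI hGY : GeometricallyIntegral ((Over.pullback (Spec.map (CommRingCat.ofHom (algebraMap ↑(W.left.presheaf.stalk t)
      (ResidueField ↑(W.left.presheaf.stalk t)))))).obj YA).hom :=
    inferInstanceAs (GeometricallyIntegral (pullback.snd YA.hom _))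
  -- (2) the two faces: `N_A := (μ ≫ (1 × a))^* N` is trivial on `{x_A} × Y_A` and on `X_A × {y_A}`
  have hsq₁ : (Y ◁ a).left ≫ (((λ_ Y).inv ≫ x ▷ Y) ▷ W).left =
      ((λ_ YA).inv ≫ xA ▷ YA).left ≫ μ.hom.left ≫ ((X ⊗ Y) ◁ a).left := by
    have h1 : ((λ_ YA).inv ≫ xA ▷ YA).left ≫ μ.hom.left = ((Over.pullback ρ').map ((λ_ Y).inv ≫ x ▷ Y)).left :=
      congrArg (fun φ => φ.left) (slice_tensorator_eq_map ρ' x Y)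
    rw [← Category.assoc _ μ.hom.left, h1, Over.whiskerLeft_left, Over.whiskerLeft_left, Over.whiskerRight_left]
    exact (lift_fst_comp_map_eq Y.hom (X ⊗ Y).hom ((λ_ Y).inv ≫ x ▷ Y).left (Over.w _) W.hom ρ'
      (W.left.fromSpecStalk t) rfl).symm
  have hsq₂ : (X ◁ a).left ≫ (((ρ_ X).inv ≫ X ◁ y) ▷ W).left =
      ((ρ_ XA).inv ≫ XA ◁ yA).left ≫ μ.hom.left ≫ ((X ⊗ Y) ◁ a).left := by
    have h1 : ((ρ_ XA).inv ≫ XA ◁ yA).left ≫ μ.hom.left = ((Over.pullback ρ').map ((ρ_ X).inv ≫ X ◁ y)).left :=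
      congrArg (fun φ => φ.left) (slice_tensorator_eq_map' ρ' X y)
    rw [← Category.assoc _ μ.hom.left, h1, Over.whiskerLeft_left, Over.whiskerLeft_left, Over.whiskerRight_left]
    exact (lift_fst_comp_map_eq X.hom (X ⊗ Y).hom ((ρ_ X).inv ≫ X ◁ y).left (Over.w _) W.hom ρ'
      (W.left.fromSpecStalk t) rfl).symm
  have h₁A := nonempty_unit_iso_pullback_pullback_of_comp_eq _ _ _ _ hsq₁ N h₁
  have h₂A := nonempty_unit_iso_pullback_pullback_of_comp_eq _ _ _ _ hsq₂ N h₂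
  -- (3) the closed fibre: `Spec(𝒪_t/𝔪) → Spec κ(t)` and the comparison with the `κ(t)`-fibre of `(X ⊗ Y) ⊗ W`
  have h𝔪 : maximalIdeal ↑(W.left.presheaf.stalk t) ≤ maximalIdeal ↑(W.left.presheaf.stalk t) ^ (0 + 1) := by
    rw [zero_add, pow_one]
  have hring : W.left.residue t ≫ CommRingCat.ofHom (Ideal.Quotient.factor h𝔪) = CommRingCat.ofHom
      (algebraMap (W.left.presheaf.stalk t) (↑(W.left.presheaf.stalk t) ⧸ maximalIdeal (W.left.presheaf.stalk t) ^ (0 + 1))) :=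
    CommRingCat.hom_ext (RingHom.ext fun r => rfl)
  have hv₀ : Spec.map (CommRingCat.ofHom (Ideal.Quotient.factor h𝔪)) ≫ Spec.map (W.left.residue t) = σ 0 :=
    (Spec.map_comp _ _).symm.trans (congrArg Spec.map hring)
  have hv : Spec.map (CommRingCat.ofHom (Ideal.Quotient.factor h𝔪)) ≫ W.left.fromSpecResidueField t =
      σ 0 ≫ W.left.fromSpecStalk t := by
    rw [← hv₀, Category.assoc]
    rfl
  obtain ⟨e₀, he₀⟩ := exists_lift_comp_map_eq (X ⊗ Y).hom ρ' W.hom (W.left.fromSpecStalk t) rfl (XA ⊗ YA).hom μ.hom.left hμ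
    (σ 0) (W.left.fromSpecResidueField t) (Spec.map (CommRingCat.ofHom (Ideal.Quotient.factor h𝔪))) hv
  have h0A : Nonempty (unitModule _ ≅ (Scheme.Modules.pullback (pullback.fst (XA ⊗ YA).hom (σ 0))).obj
      ((Scheme.Modules.pullback (μ.hom.left ≫ ((X ⊗ Y) ◁ a).left)).obj N)) := by
    refine nonempty_unit_iso_pullback_pullback_of_comp_eq e₀ _ (pullback.fst (XA ⊗ YA).hom (σ 0)) _ ?_ N hfib
    rw [Over.whiskerLeft_left, Over.whiskerLeft_left]
    exact he₀
  -- (4) Step (I) over the local ring `𝒪_{W,t}`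
  have main := cubeStepI_localRing XA YA xA yA (hPX := hPX) (hPY := hPY) (hGX := hGX) (hGY := hGY) hStX hStY
    ((Scheme.Modules.pullback (μ.hom.left ≫ ((X ⊗ Y) ◁ a).left)).obj N) hNA h₁A h₂A h0A n
  -- (5) back to the test object `Spec(𝒪_t/𝔪^{n+1}) → W` over `R`
  have hu : σ n ≫ W.left.fromSpecStalk t = g := by
    rw [hg]
    rfl
  have hs : σ n ≫ ρ' = g ≫ W.hom := by
    rw [← hu, Category.assoc]
  obtain ⟨e, he₁, he₂⟩ := exists_lift_to_local ρ' (X ⊗ Y).hom (g ≫ W.hom) (σ n) hs (XA ⊗ YA).hom μ.hom.left μ.inv.left hμi hμ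
  have fin : pullback.map (X ⊗ Y).hom (g ≫ W.hom) (X ⊗ Y).hom ρ' (𝟙 _) (σ n) (𝟙 _)
      (by rw [Category.comp_id, Category.id_comp]) (by rw [Category.comp_id, hs]) ≫ ((X ⊗ Y) ◁ a).left =
      ((X ⊗ Y) ◁ (Over.homMk g rfl : Over.mk (g ≫ W.hom) ⟶ W)).left := by
    rw [Over.whiskerLeft_left, Over.whiskerLeft_left]
    exact map_comp_map_eq_map (X ⊗ Y).hom (g ≫ W.hom) ρ' W.hom (σ n) hs (W.left.fromSpecStalk t) rfl g hu rfl
  exact nonempty_unit_iso_pullback_of_comp_comp_eq e (pullback.fst (XA ⊗ YA).hom (σ n)) (μ.hom.left ≫ ((X ⊗ Y) ◁ a).left)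
    _ (comp_comp_comp_eq_of_comp_comp_eq e _ _ _ _ he₁ _ fin) N main

end Literature.AlgebraicGeometry.Motives

end
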